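import Mathlib
import HarnessLib
import Summits.NavierStokesRegularity.NavierStokesRegularity.Theorems.QuarterLogPincerThinCascadeDefs
import Summits.NavierStokesRegularity.NavierStokesRegularity.Theorems.QuarterLogPincerTypeIQuantSubcubicExpZoomPairingLimit
import Summits.NavierStokesRegularity.NavierStokesRegularity.Theorems.QuarterLogPincerTypeIQuantSubcubicExpZoomTraceBudget

/-!
# Crux `QuarterLogPincer.TypeIQuantSubcubicExp` (stmt-NavierStokesRegularity-24077), line `thin_cascade`:
  STUB S2 `stub_thinObjectExtraction` — PROVED

Prover file (`--supports stmt-NavierStokesRegularity-24077`, lead prover ns-tc-p1 g3) landing the registered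
2nd stub of the skeleton `Cruxes/TypeIQuantSubcubicExp/Lines/thin_cascade.lean` (v5, ns-idea-7) BY NAME with
its registered signature: `UniformScaledEnergy → ∀ M q, 0 < q → (∀ K, CheapCascade M q K) →
∃ M' q' v g, ThinObject M' q' v g` — arbitrarily long cheap cascades with a fixed Type-I constant and a fixed
per-octave budget produce a thin singular Type-I ancient object.

Assembly by name of the kernel-checked blocks of the zoom-limit construction (KNSS compactness of the
Navier–Stokes zooms `v_K = ρ_K u_K(T_K + ρ_K²·, x_K + ρ_K·)` of the cheap cascades):

* (1) `exists_typeIAncientMild_zoomLimit_of_cheapCascades` (`…ZoomLimit`): a subsequence of the zooms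
  converges on the open past to a Type-I ancient mild solution `W` (`IsTypeIAncientMild M W`);
* (2) `uniformLocalEnergy_zoomLimit_of_cheapCascades` (`…ZoomEnergyLimit`): uniform unit-ball energies
  of `W` up to the final time (from STUB I1 `stub_uniformScaledEnergy`, landed);
* (3) `singularAt_zoomLimit_of_cheapCascades` (`…ZoomTypeIBoundC`): `W` is singular at the space-time
  origin (centre values `‖v_K(0,0)‖ ≥ e^K` + uniform local Type-I bounds + CKN-type ε-regularity);
* (4) `exists_traceLimit_of_cheapCascades` (`…ZoomTrace`): along a further subsequence the final slices
  `v_K(0)` converge weakly to a locally (square-)integrable trace `g`;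
* (5) `tendsto_pairing_zoomLimit_of_cheapCascades` (`…ZoomPairingLimit`): `∫⟪W(t), θ⟫ → ∫⟪g, θ⟫` as
  `t ↑ 0` for smooth compactly supported `θ` (uniform time modulus from the pairing identity);
* (6) `annulus_budget_of_weak` (`…ZoomTraceBudget`): `∫_{1<|y|<R} |g|³ ≤ q (1 + log R)` (lower
  semicontinuity of the annular cubes under weak convergence, fed by `zoom_annulus_budget`).

`M' = M`, `q' = q`.

HONEST FRAMING: this closes ONE registered stub (S2) of an open crux; the deciding stub S3
(`stub_thinCascadeLiouville`, the DSS wall: no thin singular Type-I ancient object exists) remains OPEN; the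
crux `TypeIQuantSubcubicExp`, its parent `SuperlogCubeRate` and Navier–Stokes regularity are NOT proved; no
summit statement is proved by this file.
-/

noncomputable section

-- the summit-side namespace `Summit.NavierStokesRegularity.NavierStokesRegularity.…` (single-conjunct summit,
-- D-0017) repeats a component by design; the dupNamespace linter would flag every declaration.
set_option linter.dupNamespace false

namespace Summit.NavierStokesRegularity.NavierStokesRegularity.Cruxes.TypeIQuantSubcubicExp.ThinCascade

open MeasureTheory Set Function Metric Filter Topology
open scoped ENNReal NNReal InnerProductSpace RealInnerProductSpace
open Literature.Analysis Literature.Analysis.FluidPDE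
open Summit.NavierStokesRegularity.NavierStokesRegularity.Theorems.ThinCascade

/-- Local notation for physical space `ℝ³ = EuclideanSpace ℝ (Fin 3)` (verbatim from the registered
skeleton `Lines/thin_cascade.lean`, so that the stub header below is the registered one). -/
local notation "E3" => EuclideanSpace ℝ (Fin 3)

/-- **STUB S2 of line `thin_cascade` (skeleton v5): thin-object extraction.**  Given the uniform scaled
energies (I1) — in fact unconditionally, since `stub_uniformScaledEnergy` is a theorem of the tree — for
every Type-I constant `M` and budget `q > 0`, cheap cascades of every length `K` yield a thin singular
Type-I ancient object `(M, q, W, g)`: `W` is the KNSS zoom limit of the cascades' final windows, `g` the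
weak trace of the zooms' final slices.  Clauses (1)–(6) of `ThinObject` are the tree's
`exists_typeIAncientMild_zoomLimit_of_cheapCascades`, `uniformLocalEnergy_zoomLimit_of_cheapCascades`,
`singularAt_zoomLimit_of_cheapCascades`, `exists_traceLimit_of_cheapCascades`,
`tendsto_pairing_zoomLimit_of_cheapCascades`, `annulus_budget_of_weak`. [folklore] -/
theorem stub_thinObjectExtraction :
    UniformScaledEnergy →
      ∀ M q : ℝ, 0 < q → (∀ K : ℕ, CheapCascade M q K) →
        ∃ (M' q' : ℝ) (v : ℝ → E3 → E3) (g : E3 → E3), ThinObject M' q' v g := by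
  intro _hU M q hq hK
  -- (1) the zoom limit
  obtain ⟨T, τ, ρ, x₀, u, p, φ, W, hdata, hφ, hTI, -, hpt, -⟩ :=
    exists_typeIAncientMild_zoomLimit_of_cheapCascades hK
  -- (4) the trace along a further subsequence
  obtain ⟨ψ, g, hψ, hgli, hg2, hgw⟩ := exists_traceLimit_of_cheapCascades hdata hφ
  have hφψ : StrictMono (φ ∘ ψ) := hφ.comp hψ
  have hpt' : ∀ t < 0, ∀ x, Tendsto
      (fun j => ((ρ ((φ ∘ ψ) j)) • stPull (ρ ((φ ∘ ψ) j) ^ 2) (ρ ((φ ∘ ψ) j)) (T ((φ ∘ ψ) j))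
        (x₀ ((φ ∘ ψ) j)) (u ((φ ∘ ψ) j))) t x) atTop (𝓝 (W t x)) :=
    fun t ht x => (hpt t ht x).comp hψ.tendsto_atTop
  have hgw' : ∀ (ζ : EuclideanSpace ℝ (Fin 3) → EuclideanSpace ℝ (Fin 3)), MemLp ζ 2 volume →
      ∀ (a : ℝ), (∀ y, y ∉ ball (0 : EuclideanSpace ℝ (Fin 3)) a → ζ y = 0) →
      Tendsto (fun k => ∫ y, ⟪((ρ ((φ ∘ ψ) k)) • stPull (ρ ((φ ∘ ψ) k) ^ 2) (ρ ((φ ∘ ψ) k))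
        (T ((φ ∘ ψ) k)) (x₀ ((φ ∘ ψ) k)) (u ((φ ∘ ψ) k))) 0 y, ζ y⟫) atTop (𝓝 (∫ y, ⟪g y, ζ y⟫)) :=
    hgw
  refine ⟨M, q, W, g, hTI, uniformLocalEnergy_zoomLimit_of_cheapCascades hdata hφ hpt,
    singularAt_zoomLimit_of_cheapCascades hdata hφ hpt, hgli,
    tendsto_pairing_zoomLimit_of_cheapCascades hdata hφψ hpt' hgw', ?_⟩
  -- (6) the annular budget of the trace
  have hVc : ∀ k, Continuous (((ρ ((φ ∘ ψ) k)) • stPull (ρ ((φ ∘ ψ) k) ^ 2) (ρ ((φ ∘ ψ) k))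
      (T ((φ ∘ ψ) k)) (x₀ ((φ ∘ ψ) k)) (u ((φ ∘ ψ) k))) 0) := by
    intro k
    have hcl := (hdata ((φ ∘ ψ) k)).1.1
    have hT : T ((φ ∘ ψ) k) ∈ Icc 0 (T ((φ ∘ ψ) k)) :=
      ⟨le_trans (by positivity) (hdata ((φ ∘ ψ) k)).2.2.2.1, le_rfl⟩
    have huc : Continuous (u ((φ ∘ ψ) k) (T ((φ ∘ ψ) k))) := (hcl.contDiff_velocity hT).continuous
    have e : ((ρ ((φ ∘ ψ) k)) • stPull (ρ ((φ ∘ ψ) k) ^ 2) (ρ ((φ ∘ ψ) k)) (T ((φ ∘ ψ) k))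
        (x₀ ((φ ∘ ψ) k)) (u ((φ ∘ ψ) k))) 0 = fun y => (ρ ((φ ∘ ψ) k)) •
          u ((φ ∘ ψ) k) (T ((φ ∘ ψ) k) + ρ ((φ ∘ ψ) k) ^ 2 * 0)
            (x₀ ((φ ∘ ψ) k) + (ρ ((φ ∘ ψ) k)) • y) := by
      funext y; simp only [smul_stPull_apply]
    rw [e, mul_zero, add_zero]
    have hlin : Continuous fun y : EuclideanSpace ℝ (Fin 3) => x₀ ((φ ∘ ψ) k) + (ρ ((φ ∘ ψ) k)) • y :=
      continuous_const.add (continuous_id.const_smul (ρ ((φ ∘ ψ) k)))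
    exact (huc.comp hlin).const_smul (ρ ((φ ∘ ψ) k))
  have hbudget : ∀ j : ℕ, 1 ≤ j → ∀ᶠ k in atTop,
      ∫⁻ y in {y : EuclideanSpace ℝ (Fin 3) | 1 < ‖y‖ ∧ ‖y‖ < Real.exp j},
        ENNReal.ofReal (‖((ρ ((φ ∘ ψ) k)) • stPull (ρ ((φ ∘ ψ) k) ^ 2) (ρ ((φ ∘ ψ) k))
          (T ((φ ∘ ψ) k)) (x₀ ((φ ∘ ψ) k)) (u ((φ ∘ ψ) k))) 0 y‖ ^ 3) ≤ ENNReal.ofReal (q * j) := by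
    intro j hj
    filter_upwards [eventually_ge_atTop j] with k hk
    exact zoom_annulus_budget (hdata ((φ ∘ ψ) k)).2.2.1 (hdata ((φ ∘ ψ) k)).2.2.2.2.2.2.2 j hj
      (hk.trans (hφψ.id_le k))
  exact annulus_budget_of_weak hVc hgli.aestronglyMeasurable hg2 hgw' hq.le hbudget

end Summit.NavierStokesRegularity.NavierStokesRegularity.Cruxes.TypeIQuantSubcubicExp.ThinCascade

end
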